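import Literature.Combinatorics.SimpleGraph.HamiltonianParitySystem
import HarnessLib

/-!
# A parity-system → directed Hamiltonian cycle gadget construction, III: the tour of the zero system

Continuation of `HamiltonianParitySystem.lean` (support for the discharge of
`Literature.ModelTheory.FiniteModelTheory.AtseriasDawarOchremiak2021_hamiltonicity_countingWidth`).
COMPLETENESS of the gadget digraph for the homogeneous system `b = 0` (the only case the counting-width
argument needs: the Cai–Fürer–Immerman pair is "twisted system vs. its homogeneous companion", cf.
Atserias–Dawar 2019, Lemma 3.2: "the system `G(I⁰)` is satisfiable for any `I`"): an explicit directed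
Hamiltonian cycle `tour vr` of `Arc vr 0`, hence (tree: `isHamiltonian_splitGraph_iff`) the split graph
of `Arc vr 0` is Hamiltonian (`isHamiltonian_zero`).

The tour realises the all-zero solution: for every variable `v` the piece
`cx v, hd v 0, K(v,0) left to right — each segment `λ α p · bm u i c (c+1) · q β ρ` detouring through
the block middle vertex served by its link —, tl v 0, tl v 1, K(v,1) right to left, hd v 1`; then
`cx n`; for every constraint `u` the piece `ce u` followed by the two straight passes
`bx u 0 0, bm u 0 0 0, …, bx u 3 0, bx u 0 1, bm u 0 1 1, …, bx u 3 1`; then `ce m`, closing up at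
`cx 0`. The file proves that this list is a chain of arcs closing up (`isChain_tour_and_wrap`), visits
every vertex (`mem_tour`) and has no duplicates (`nodup_tour`, by an ownership argument), i.e. is an
`IsHamCycleListing` (`isHamCycleListing_tour`). The slot bookkeeping (`allOcc`, `occs`, first/next/last
slots along the filtered reading order) reuses the list lemmas of the tree's `HamiltonianSatGadget.lean`
(`SatDHam.isChain_filter_next`, `SatDHam.isChain_flatMap`, …).

## References

* A. Atserias, A. Dawar, J. Ochremiak, J. ACM 68 (2021), arXiv:1901.07825, §5.2, Lemma 14.
* A. Atserias, A. Dawar, J. Log. Comput. 29 (2019), arXiv:1806.11307, Lemma 3.2 / 3.3(1).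
* S. Arora, B. Barak, *Computational Complexity*, Thm 2.17 (proof: the tour through the chains).
-/

namespace Literature.Combinatorics.SimpleGraph

namespace XorHam

open Vtx

variable {n m : ℕ} (vr : Fin m → Fin 3 → Fin n)

/-! ### Completeness for `b = 0`: an explicit directed Hamiltonian cycle -/

section Tour

/-! #### All occurrence slots in reading order -/

/-- Decoding a reading position. [folklore] -/
def decode (k : Fin (m * 6)) : Occ m :=
  (⟨k / 6, (Nat.div_lt_iff_lt_mul (by norm_num)).2 k.2⟩,
    ⟨k % 6 / 2, by have := Nat.mod_lt (k : ℕ) (show 0 < 6 by norm_num); omega⟩,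
    ⟨k % 2, Nat.mod_lt _ (by norm_num)⟩)

/-- Decoding inverts the reading position. [folklore] -/
theorem flat_decode (k : Fin (m * 6)) : flat (decode k) = k := by
  simp only [flat, decode]
  omega

variable (m) in
/-- All occurrence slots, in reading order. [folklore] -/
def allOcc : List (Occ m) := List.ofFn fun k : Fin (m * 6) => decode k

/-- Every slot is listed. [folklore] -/
theorem mem_allOcc (o : Occ m) : o ∈ allOcc m := by
  rw [allOcc, List.mem_ofFn]
  have ho : flat o < m * 6 := by
    rcases o with ⟨u, i, c⟩
    have := u.2; have := i.2; have := c.2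
    simp only [flat]; omega
  exact ⟨⟨flat o, ho⟩, flat_injective (flat_decode _)⟩

/-- `allOcc` is sorted by reading position. [folklore] -/
theorem pairwise_allOcc : (allOcc m).Pairwise fun a b => flat a < flat b := by
  rw [allOcc, List.pairwise_ofFn]
  intro i j hij
  rw [flat_decode, flat_decode]
  exact hij

/-- `allOcc` has no duplicates. [folklore] -/
theorem nodup_allOcc : (allOcc m).Nodup :=
  pairwise_allOcc.imp fun h e => by subst e; exact lt_irrefl _ h

/-- The slots of the variable `v`, in reading order. [folklore] -/
def occs (v : Fin n) : List (Occ m) := (allOcc m).filter fun o => decide (var vr o = v)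

section TourLemmas

variable {vr}

/-- Membership in `occs`. [folklore] -/
theorem mem_occs {v : Fin n} {o : Occ m} : o ∈ occs vr v ↔ var vr o = v := by
  simp [occs, mem_allOcc]

/-- `occs` has no duplicates. [folklore] -/
theorem nodup_occs (v : Fin n) : (occs vr v).Nodup := nodup_allOcc.filter _

/-- Consecutive slots of a variable are next slots. [folklore] -/
theorem isChain_occs (v : Fin n) : (occs vr v).IsChain (IsNextOcc vr) := by
  refine (SatDHam.isChain_filter_next flat (fun o => var vr o = v) pairwise_allOcc).imp fun a c hac => ?_
  obtain ⟨ha, hc, hlt, hnext⟩ := hac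
  exact ⟨hc.trans ha.symm, hlt, fun o'' hv hlt' => hnext o'' (mem_allOcc _) (hv.trans ha) hlt'⟩

/-- A variable occurs iff it has slots. [folklore] -/
theorem occs_ne_nil_iff {v : Fin n} : occs vr v ≠ [] ↔ Occurs vr v := by
  constructor
  · intro h
    obtain ⟨o, hl⟩ := List.exists_mem_of_ne_nil _ h
    exact ⟨o, mem_occs.1 hl⟩
  · rintro ⟨o, ho⟩
    exact List.ne_nil_of_mem (mem_occs.2 ho)

/-- The head of `occs v` is the first slot of `v`. [folklore] -/
theorem head?_occs {v : Fin n} {o : Occ m} (ho : (occs vr v).head? = some o) :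
    var vr o = v ∧ IsFirst vr o :=
  ⟨mem_occs.1 (List.mem_of_mem_head? ho), fun o' ho' =>
    SatDHam.head_filter_le flat (fun o => var vr o = v) pairwise_allOcc ho (mem_allOcc o')
      (ho'.trans (mem_occs.1 (List.mem_of_mem_head? ho)))⟩

/-- The last entry of `occs v` is the last slot of `v`. [folklore] -/
theorem getLast?_occs {v : Fin n} {o : Occ m} (ho : (occs vr v).getLast? = some o) :
    var vr o = v ∧ IsLast vr o :=
  ⟨mem_occs.1 (List.mem_of_getLast? ho), fun o' ho' =>
    SatDHam.le_getLast_filter flat (fun o => var vr o = v) pairwise_allOcc ho (mem_allOcc o')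
      (ho'.trans (mem_occs.1 (List.mem_of_getLast? ho)))⟩

/-! #### The pieces of the tour -/

/-- The link copy as an element of `ZMod 2`. [folklore] -/
def toZ (c : Fin 2) : ZMod 2 := (c : ℕ)

/-- Both tracks arise as link copies. [folklore] -/
theorem exists_toZ_eq (t : ZMod 2) : ∃ c : Fin 2, toZ c = t := by
  revert t; decide

/-- `toZ` is injective. [folklore] -/
theorem toZ_injective : Function.Injective toZ := by
  intro c c' h; revert c c' h; decide

/-- The segment of slot `o` on copy `0`, left to right, with the detour through the block middle
vertex `bm u i c (c+1)` served by its link. [folklore] -/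
def segLR (o : Occ m) : List (Vtx n m) :=
  [nd 0 o 0, nd 0 o 1, nd 0 o 2, bm o.1 o.2.1 (toZ o.2.2) (toZ o.2.2 + 1), nd 0 o 3, nd 0 o 4, nd 0 o 5]

/-- The segment of slot `o` on copy `1`, right to left. [folklore] -/
def segRL (o : Occ m) : List (Vtx n m) :=
  [nd 1 o 5, nd 1 o 4, nd 1 o 3, nd 1 o 2, nd 1 o 1, nd 1 o 0]

end TourLemmas

/-- The chain `K(v,0)` traversed left to right. [folklore] -/
def lrPart (v : Fin n) : List (Vtx n m) := (occs vr v).flatMap segLR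

/-- The chain `K(v,1)` traversed right to left. [folklore] -/
def rlPart (v : Fin n) : List (Vtx n m) := (occs vr v).reverse.flatMap segRL

/-- The piece of variable `v`: `cx v, hd v 0, K(v,0) →, tl v 0, tl v 1, K(v,1) ←, hd v 1`. [folklore] -/
def varPiece (v : Fin n) : List (Vtx n m) :=
  cx v.castSucc :: hd v 0 :: (lrPart vr v ++ tl v 0 :: tl v 1 :: (rlPart vr v ++ [hd v 1]))

/-- The piece of constraint `u`: `ce u` and the two straight passes through the block. [folklore] -/
def blockPiece (u : Fin m) : List (Vtx n m) :=
  [ce u.castSucc, bx u 0 0, bm u 0 0 0, bx u 1 0, bm u 1 0 0, bx u 2 0, bm u 2 0 0, bx u 3 0,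
    bx u 0 1, bm u 0 1 1, bx u 1 1, bm u 1 1 1, bx u 2 1, bm u 2 1 1, bx u 3 1]

/-- **The tour** of the zero system: variable pieces, `cx n`, block pieces, `ce m`. [folklore] -/
def tour : List (Vtx n m) :=
  (List.finRange n).flatMap (varPiece vr) ++
    cx (Fin.last n) :: ((List.finRange m).flatMap (blockPiece (n := n)) ++ [ce (Fin.last m)])

section TourProofs

variable {vr}

/-- Variable pieces are nonempty. [folklore] -/
theorem varPiece_ne_nil (v : Fin n) : varPiece vr v ≠ [] := List.cons_ne_nil _ _

/-- Block pieces are nonempty. [folklore] -/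
theorem blockPiece_ne_nil (u : Fin m) : blockPiece (n := n) u ≠ [] := List.cons_ne_nil _ _

/-! #### The pieces are paths -/

/-- Forward segment arcs. [folklore] -/
theorem arc_nd_fwd (b : Fin m → ZMod 2) (a : ZMod 2) (o : Occ m) {s s' : Fin 6}
    (h : (s : ℕ) + 1 = s') : Arc vr b (nd a o s) (nd a o s') :=
  ⟨rfl, Or.inl ⟨rfl, Or.inl h⟩⟩

/-- Backward segment arcs. [folklore] -/
theorem arc_nd_bwd (b : Fin m → ZMod 2) (a : ZMod 2) (o : Occ m) {s s' : Fin 6}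
    (h : (s' : ℕ) + 1 = s) : Arc vr b (nd a o s) (nd a o s') :=
  ⟨rfl, Or.inl ⟨rfl, Or.inr h⟩⟩

/-- A left-to-right segment with its detour is a path. [folklore] -/
theorem isChain_segLR (o : Occ m) : (segLR o).IsChain (Arc vr 0) := by
  simp only [segLR, List.isChain_cons_cons, List.isChain_singleton, and_true]
  refine ⟨arc_nd_fwd 0 0 o rfl, arc_nd_fwd 0 0 o rfl, ?_, ?_, arc_nd_fwd 0 0 o rfl,
    arc_nd_fwd 0 0 o rfl⟩
  · simp [Arc]
  · simp [Arc]

/-- A right-to-left segment is a path. [folklore] -/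
theorem isChain_segRL (o : Occ m) : (segRL o).IsChain (Arc vr 0) := by
  simp only [segRL, List.isChain_cons_cons, List.isChain_singleton, and_true]
  exact ⟨arc_nd_bwd 0 1 o rfl, arc_nd_bwd 0 1 o rfl, arc_nd_bwd 0 1 o rfl, arc_nd_bwd 0 1 o rfl,
    arc_nd_bwd 0 1 o rfl⟩

/-- Segments are nonempty (left to right). [folklore] -/
theorem segLR_ne_nil (o : Occ m) : segLR (n := n) o ≠ [] := List.cons_ne_nil _ _

/-- Segments are nonempty (right to left). [folklore] -/
theorem segRL_ne_nil (o : Occ m) : segRL (n := n) o ≠ [] := List.cons_ne_nil _ _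

/-- `K(v,0)` traversed left to right is a path. [folklore] -/
theorem isChain_lrPart (v : Fin n) : (lrPart vr v).IsChain (Arc vr 0) := by
  refine SatDHam.isChain_flatMap (fun o _ => segLR_ne_nil o) (fun o _ => isChain_segLR o) ?_
  refine (isChain_occs (vr := vr) v).imp fun o o' hn a ha c hc => ?_
  simp only [segLR, List.getLast?_cons_cons, List.getLast?_singleton, Option.mem_def,
    Option.some.injEq, List.head?_cons] at ha hc
  subst ha; subst hc
  exact ⟨rfl, Or.inr (Or.inl ⟨rfl, rfl, hn⟩)⟩

/-- `K(v,1)` traversed right to left is a path. [folklore] -/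
theorem isChain_rlPart (v : Fin n) : (rlPart vr v).IsChain (Arc vr 0) := by
  refine SatDHam.isChain_flatMap (fun o _ => segRL_ne_nil o) (fun o _ => isChain_segRL o) ?_
  rw [List.isChain_reverse]
  refine (isChain_occs (vr := vr) v).imp fun o o' hn a ha c hc => ?_
  simp only [segRL, List.getLast?_cons_cons, List.getLast?_singleton, Option.mem_def,
    Option.some.injEq, List.head?_cons] at ha hc
  subst ha; subst hc
  exact ⟨rfl, Or.inr (Or.inr ⟨rfl, rfl, hn⟩)⟩

/-- The first vertex of `K(v,0) →`. [folklore] -/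
theorem head?_lrPart (v : Fin n) :
    (lrPart vr v).head? = (occs vr v).head?.map fun o => nd 0 o 0 := by
  rw [lrPart, SatDHam.head?_flatMap_of_ne_nil fun o _ => segLR_ne_nil o]
  cases (occs vr v).head? <;> rfl

/-- The last vertex of `K(v,0) →`. [folklore] -/
theorem getLast?_lrPart (v : Fin n) :
    (lrPart vr v).getLast? = (occs vr v).getLast?.map fun o => nd 0 o 5 := by
  rw [lrPart, SatDHam.getLast?_flatMap_of_ne_nil fun o _ => segLR_ne_nil o]
  cases (occs vr v).getLast? <;> simp [segLR]

/-- The first vertex of `K(v,1) ←`. [folklore] -/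
theorem head?_rlPart (v : Fin n) :
    (rlPart vr v).head? = (occs vr v).getLast?.map fun o => nd 1 o 5 := by
  rw [rlPart, SatDHam.head?_flatMap_of_ne_nil fun o _ => segRL_ne_nil o, List.head?_reverse]
  cases (occs vr v).getLast? <;> rfl

/-- The last vertex of `K(v,1) ←`. [folklore] -/
theorem getLast?_rlPart (v : Fin n) :
    (rlPart vr v).getLast? = (occs vr v).head?.map fun o => nd 1 o 0 := by
  rw [rlPart, SatDHam.getLast?_flatMap_of_ne_nil fun o _ => segRL_ne_nil o, List.getLast?_reverse]
  cases (occs vr v).head? <;> simp [segRL]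

/-- **A variable piece is a path.** [folklore] -/
theorem isChain_varPiece (v : Fin n) : (varPiece vr v).IsChain (Arc vr 0) := by
  rw [varPiece, List.isChain_cons]
  refine ⟨fun y hy => ?_, ?_⟩
  · simp only [List.head?_cons, Option.mem_def, Option.some.injEq] at hy
    subst hy; exact (rfl : Fin.castSucc v = Fin.castSucc v)
  rw [List.isChain_cons]
  by_cases hocc : Occurs vr v
  · -- the variable occurs: both chains are nonempty
    have hne : occs vr v ≠ [] := occs_ne_nil_iff.2 hocc
    obtain ⟨of, hof⟩ : ∃ o, (occs vr v).head? = some o :=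
      Option.isSome_iff_exists.1 (List.isSome_head?.2 hne)
    obtain ⟨ol, hol⟩ : ∃ o, (occs vr v).getLast? = some o :=
      Option.isSome_iff_exists.1 (List.getLast?_isSome.2 hne)
    obtain ⟨hvf, hff⟩ := head?_occs hof
    obtain ⟨hvl, hll⟩ := getLast?_occs hol
    refine ⟨fun y hy => ?_, ?_⟩
    · rw [List.head?_append, head?_lrPart, hof, Option.map_some, Option.some_or, Option.mem_def,
        Option.some.injEq] at hy
      subst hy
      exact ⟨rfl, rfl, hvf, hff⟩
    refine List.IsChain.append (isChain_lrPart v) ?_ fun x hx y hy => ?_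
    · rw [List.isChain_cons]
      refine ⟨fun y hy => ?_, ?_⟩
      · simp only [List.head?_cons, Option.mem_def, Option.some.injEq] at hy
        subst hy; exact ⟨rfl, by decide⟩
      rw [List.isChain_cons]
      refine ⟨fun y hy => ?_, List.IsChain.append (isChain_rlPart v) (List.isChain_singleton _)
        fun x hx y hy => ?_⟩
      · rw [List.head?_append, head?_rlPart, hol, Option.map_some, Option.some_or, Option.mem_def,
          Option.some.injEq] at hy
        subst hy
        exact ⟨rfl, rfl, hvl, hll⟩
      · rw [getLast?_rlPart, hof, Option.map_some, Option.mem_def, Option.some.injEq] at hx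
        simp only [List.head?_cons, Option.mem_def, Option.some.injEq] at hy
        subst hx; subst hy
        exact ⟨rfl, rfl, hvf, hff⟩
    · rw [getLast?_lrPart, hol, Option.map_some, Option.mem_def, Option.some.injEq] at hx
      simp only [List.head?_cons, Option.mem_def, Option.some.injEq] at hy
      subst hx; subst hy
      exact ⟨rfl, rfl, hvl, hll⟩
  · -- the variable does not occur: both chains are empty
    have hnil : occs vr v = [] := by
      by_contra h; exact hocc (occs_ne_nil_iff.1 h)
    have h1 : lrPart vr v = [] := by rw [lrPart, hnil]; rfl
    have h2 : rlPart vr v = [] := by rw [rlPart, hnil]; rfl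
    rw [h1, h2]
    simp only [List.nil_append, List.head?_cons, Option.mem_def, Option.some.injEq, forall_eq',
      List.isChain_cons_cons, List.isChain_singleton, and_true]
    exact ⟨⟨rfl, rfl, hocc⟩, ⟨rfl, by decide⟩, ⟨rfl, rfl, hocc⟩⟩

/-- Small `Fin` identities used in the blocks. [folklore] -/
theorem fin_block_facts : ((0 : Fin 3).castSucc : Fin 4) = 0 ∧ ((1 : Fin 3).castSucc : Fin 4) = 1 ∧
    ((2 : Fin 3).castSucc : Fin 4) = 2 ∧ ((0 : Fin 3).succ : Fin 4) = 1 ∧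
    ((1 : Fin 3).succ : Fin 4) = 2 ∧ ((2 : Fin 3).succ : Fin 4) = 3 := by
  decide

/-- **A block piece is a path** (for the zero right-hand side). [folklore] -/
theorem isChain_blockPiece (u : Fin m) : (blockPiece (n := n) u).IsChain (Arc vr 0) := by
  obtain ⟨c0, c1, c2, s0, s1, s2⟩ := fin_block_facts
  simp only [blockPiece, List.isChain_cons_cons, List.isChain_singleton, Arc, c0, c1, c2,
    s0, s1, s2, Pi.zero_apply, and_self]

/-! #### Assembling the tour -/

/-- The first vertex of a variable piece. [folklore] -/
theorem head?_varPiece (v : Fin n) : (varPiece vr v).head? = some (cx v.castSucc) := rfl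

/-- The last vertex of a variable piece. [folklore] -/
theorem getLast?_varPiece (v : Fin n) : (varPiece vr v).getLast? = some (hd v 1) := by
  rw [varPiece, show cx v.castSucc :: hd v 0 :: (lrPart vr v ++ tl v 0 :: tl v 1 :: (rlPart vr v ++ [hd v 1])) =
    (cx v.castSucc :: hd v 0 :: (lrPart vr v ++ tl v 0 :: tl v 1 :: rlPart vr v)) ++ [hd v 1] by simp,
    List.getLast?_append]
  rfl

/-- The first vertex of a block piece. [folklore] -/
theorem head?_blockPiece (u : Fin m) : (blockPiece (n := n) u).head? = some (ce u.castSucc) := rfl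

/-- The last vertex of a block piece. [folklore] -/
theorem getLast?_blockPiece (u : Fin m) : (blockPiece (n := n) u).getLast? = some (bx u 3 1) := by
  simp [blockPiece]

/-- Consecutive entries of `finRange` are consecutive. [folklore] -/
theorem isChain_finRange_succ (k : ℕ) :
    (List.finRange k).IsChain fun a b : Fin k => (b : ℕ) = a + 1 := by
  rw [List.isChain_iff_getElem]
  intro i hi
  simp [List.getElem_finRange]

/-- The last entry of `finRange (k+1)`. [folklore] -/
theorem getLast?_finRange_succ (k : ℕ) : (List.finRange (k + 1)).getLast? = some (Fin.last k) := by
  rw [List.getLast?_eq_getElem?, List.length_finRange, Nat.add_sub_cancel, List.getElem?_eq_getElem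
    (by simp), List.getElem_finRange]
  rfl

/-- The variable pieces concatenate to a path. [folklore] -/
theorem isChain_varPieces : ((List.finRange n).flatMap (varPiece vr)).IsChain (Arc vr 0) := by
  refine SatDHam.isChain_flatMap (fun v _ => varPiece_ne_nil v) (fun v _ => isChain_varPiece v) ?_
  refine (isChain_finRange_succ n).imp fun v v' hvv' x hx y hy => ?_
  rw [getLast?_varPiece, Option.mem_def, Option.some.injEq] at hx
  rw [head?_varPiece, Option.mem_def, Option.some.injEq] at hy
  subst hx; subst hy
  exact Fin.ext (by simp [hvv'])

/-- The block pieces concatenate to a path. [folklore] -/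
theorem isChain_blockPieces :
    ((List.finRange m).flatMap (blockPiece (n := n))).IsChain (Arc vr 0) := by
  refine SatDHam.isChain_flatMap (fun u _ => blockPiece_ne_nil u) (fun u _ => isChain_blockPiece u) ?_
  refine (isChain_finRange_succ m).imp fun u u' huu' x hx y hy => ?_
  rw [getLast?_blockPiece, Option.mem_def, Option.some.injEq] at hx
  rw [head?_blockPiece, Option.mem_def, Option.some.injEq] at hy
  subst hx; subst hy
  exact ⟨rfl, by simp, Fin.ext (by simp [huu'])⟩

/-- The last vertex of the tour. [folklore] -/
theorem getLast?_tour : (tour vr).getLast? = some (ce (Fin.last m)) := by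
  rw [tour, List.getLast?_append,
    show cx (Fin.last n) :: ((List.finRange m).flatMap (blockPiece (n := n)) ++ [ce (Fin.last m)]) =
      (cx (Fin.last n) :: (List.finRange m).flatMap (blockPiece (n := n))) ++ [ce (Fin.last m)] from rfl,
    List.getLast?_append]
  rfl

/-- The first vertex of the tour. [folklore] -/
theorem head?_tour : (tour vr).head? = some (cx 0) := by
  rw [tour, List.head?_append]
  rcases Nat.eq_zero_or_pos n with hn | hn
  · subst hn; rfl
  · rw [SatDHam.head?_flatMap_of_ne_nil fun v _ => varPiece_ne_nil v, List.head?_eq_getElem?,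
      List.getElem?_eq_getElem (by simpa using hn)]
    simp [List.getElem_finRange, head?_varPiece]

/-- **The tour is a closed path**: consecutive arcs and the wrap-around arc. [folklore] -/
theorem isChain_tour_and_wrap :
    (tour vr).IsChain (Arc vr 0) ∧ ∀ hl : tour vr ≠ [], Arc vr 0 ((tour vr).getLast hl) ((tour vr).head hl) := by
  constructor
  · rw [tour]
    refine List.IsChain.append isChain_varPieces ?_ fun x hx y hy => ?_
    · rw [List.isChain_cons]
      refine ⟨fun y hy => ?_, List.IsChain.append isChain_blockPieces (List.isChain_singleton _)
        fun x hx y hy => ?_⟩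
      · -- `cx n → ce 0`
        rcases Nat.eq_zero_or_pos m with hm | hm
        · subst hm
          simp only [List.finRange_zero, List.flatMap_nil, List.nil_append, List.head?_cons,
            Option.mem_def, Option.some.injEq] at hy
          subst hy
          exact ⟨rfl, Fin.last_zero⟩
        · rw [List.head?_append, SatDHam.head?_flatMap_of_ne_nil fun u _ => blockPiece_ne_nil u,
            List.head?_eq_getElem?, List.getElem?_eq_getElem (by simpa using hm)] at hy
          simp only [List.getElem_finRange, Option.bind_some, head?_blockPiece, Option.some_or,
            Option.mem_def, Option.some.injEq] at hy
          subst hy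
          exact ⟨rfl, rfl⟩
      · -- last block `→ ce m`
        simp only [List.head?_cons, Option.mem_def, Option.some.injEq] at hy
        subst hy
        rcases Nat.eq_zero_or_pos m with hm | hm
        · subst hm; simp at hx
        · obtain ⟨k, rfl⟩ : ∃ k, m = k + 1 := ⟨m - 1, by omega⟩
          rw [SatDHam.getLast?_flatMap_of_ne_nil fun u _ => blockPiece_ne_nil u,
            getLast?_finRange_succ, Option.bind_some, getLast?_blockPiece, Option.mem_def,
            Option.some.injEq] at hx
          subst hx
          exact ⟨rfl, by simp, (Fin.succ_last k).symm⟩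
    · -- last variable `→ cx n`
      simp only [List.head?_cons, Option.mem_def, Option.some.injEq] at hy
      subst hy
      rcases Nat.eq_zero_or_pos n with hn | hn
      · subst hn; simp at hx
      · obtain ⟨k, rfl⟩ : ∃ k, n = k + 1 := ⟨n - 1, by omega⟩
        rw [SatDHam.getLast?_flatMap_of_ne_nil fun v _ => varPiece_ne_nil v,
          getLast?_finRange_succ, Option.bind_some, getLast?_varPiece, Option.mem_def,
          Option.some.injEq] at hx
        subst hx
        exact (Fin.succ_last k).symm
  · intro hl
    have hlast : (tour vr).getLast hl = ce (Fin.last m) := by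
      rw [← Option.some_inj, ← List.getLast?_eq_some_getLast, getLast?_tour]
    have hhead : (tour vr).head hl = cx 0 := by
      rw [← Option.some_inj, ← List.head?_eq_some_head, head?_tour]
    rw [hlast, hhead]
    exact ⟨rfl, rfl⟩

/-! #### Every vertex is on the tour -/

/-- Membership in the tour, by pieces. [folklore] -/
theorem mem_tour_iff {x : Vtx n m} : x ∈ tour vr ↔
    (∃ v, x ∈ varPiece vr v) ∨ x = cx (Fin.last n) ∨ (∃ u, x ∈ blockPiece (n := n) u) ∨
      x = ce (Fin.last m) := by
  simp only [tour, List.mem_append, List.mem_flatMap, List.mem_finRange, true_and, List.mem_cons,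
    List.not_mem_nil, or_false]

/-- The two values of `ZMod 2`. [folklore] -/
theorem zmod2_cases (a : ZMod 2) : a = 0 ∨ a = 1 := by
  revert a; decide

/-- Segment vertices of copy `0` are on their segment. [folklore] -/
theorem nd_zero_mem_segLR (o : Occ m) (s : Fin 6) : nd 0 o s ∈ segLR (n := n) o := by
  fin_cases s <;> simp [segLR]

/-- Segment vertices of copy `1` are on their segment. [folklore] -/
theorem nd_one_mem_segRL (o : Occ m) (s : Fin 6) : nd 1 o s ∈ segRL (n := n) o := by
  fin_cases s <;> simp [segRL]

/-- Members of `K(v,0) →`. [folklore] -/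
theorem mem_lrPart_iff {v : Fin n} {x : Vtx n m} :
    x ∈ lrPart vr v ↔ ∃ o, var vr o = v ∧ x ∈ segLR o := by
  simp [lrPart, List.mem_flatMap, mem_occs]

/-- Members of `K(v,1) ←`. [folklore] -/
theorem mem_rlPart_iff {v : Fin n} {x : Vtx n m} :
    x ∈ rlPart vr v ↔ ∃ o, var vr o = v ∧ x ∈ segRL o := by
  simp [rlPart, List.mem_flatMap, mem_occs]

/-- Members of a variable piece. [folklore] -/
theorem mem_varPiece_iff {v : Fin n} {x : Vtx n m} : x ∈ varPiece vr v ↔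
    x = cx v.castSucc ∨ x = hd v 0 ∨ x ∈ lrPart vr v ∨ x = tl v 0 ∨ x = tl v 1 ∨ x ∈ rlPart vr v ∨
      x = hd v 1 := by
  simp only [varPiece, List.mem_cons, List.mem_append, List.not_mem_nil, or_false]

/-- **Every vertex is on the tour.** [folklore] -/
theorem mem_tour (x : Vtx n m) : x ∈ tour vr := by
  rw [mem_tour_iff]
  cases x with
  | cx j =>
    rcases Fin.eq_castSucc_or_eq_last j with ⟨v, rfl⟩ | rfl
    · exact Or.inl ⟨v, mem_varPiece_iff.2 (Or.inl rfl)⟩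
    · exact Or.inr (Or.inl rfl)
  | ce j =>
    rcases Fin.eq_castSucc_or_eq_last j with ⟨u, rfl⟩ | rfl
    · exact Or.inr (Or.inr (Or.inl ⟨u, by simp [blockPiece]⟩))
    · exact Or.inr (Or.inr (Or.inr rfl))
  | hd v a =>
    refine Or.inl ⟨v, mem_varPiece_iff.2 ?_⟩
    rcases zmod2_cases a with rfl | rfl
    · exact Or.inr (Or.inl rfl)
    · exact Or.inr (Or.inr (Or.inr (Or.inr (Or.inr (Or.inr rfl)))))
  | tl v a =>
    refine Or.inl ⟨v, mem_varPiece_iff.2 ?_⟩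
    rcases zmod2_cases a with rfl | rfl
    · exact Or.inr (Or.inr (Or.inr (Or.inl rfl)))
    · exact Or.inr (Or.inr (Or.inr (Or.inr (Or.inl rfl))))
  | nd a o s =>
    refine Or.inl ⟨var vr o, mem_varPiece_iff.2 ?_⟩
    rcases zmod2_cases a with rfl | rfl
    · exact Or.inr (Or.inr (Or.inl (mem_lrPart_iff.2 ⟨o, rfl, nd_zero_mem_segLR o s⟩)))
    · exact Or.inr (Or.inr (Or.inr (Or.inr (Or.inr (Or.inl
        (mem_rlPart_iff.2 ⟨o, rfl, nd_one_mem_segRL o s⟩))))))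
  | bx u ℓ s =>
    refine Or.inr (Or.inr (Or.inl ⟨u, ?_⟩))
    rcases zmod2_cases s with rfl | rfl <;> fin_cases ℓ <;> simp [blockPiece]
  | bm u i t t' =>
    by_cases ht : t = t'
    · subst ht
      refine Or.inr (Or.inr (Or.inl ⟨u, ?_⟩))
      rcases zmod2_cases t with rfl | rfl <;> fin_cases i <;> simp [blockPiece]
    · have ht' : t' = t + 1 := by revert t t' ht; decide
      subst ht'
      obtain ⟨c, rfl⟩ := exists_toZ_eq t
      refine Or.inl ⟨vr u i, mem_varPiece_iff.2 (Or.inr (Or.inr (Or.inl (mem_lrPart_iff.2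
        ⟨(u, i, c), rfl, ?_⟩))))⟩
      simp [segLR]

/-! #### The tour has no duplicates -/

/-- The owner of a vertex: the variable piece (`inl v`, or `inl n` for `cx n`) or the block piece
(`inr u`, or `inr m` for `ce m`) it lies on. [folklore] -/
def owner : Vtx n m → Fin (n + 1) ⊕ Fin (m + 1)
  | cx j => Sum.inl j
  | ce j => Sum.inr j
  | hd v _ => Sum.inl v.castSucc
  | tl v _ => Sum.inl v.castSucc
  | nd _ o _ => Sum.inl (var vr o).castSucc
  | bx u _ _ => Sum.inr u.castSucc
  | bm u i t t' => if t = t' then Sum.inr u.castSucc else Sum.inl (vr u i).castSucc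

/-- Members of a left-to-right segment are owned by its variable. [folklore] -/
theorem owner_of_mem_segLR {o : Occ m} {x : Vtx n m} (hx : x ∈ segLR o) :
    owner (vr := vr) x = Sum.inl (var vr o).castSucc := by
  simp only [segLR, List.mem_cons, List.not_mem_nil, or_false] at hx
  rcases hx with rfl | rfl | rfl | rfl | rfl | rfl | rfl <;> try rfl
  simp only [owner]
  rw [if_neg (by have := zmod2_cases (toZ o.2.2); rcases this with h | h <;> rw [h] <;> decide)]
  rfl

/-- Members of a right-to-left segment are owned by its variable. [folklore] -/
theorem owner_of_mem_segRL {o : Occ m} {x : Vtx n m} (hx : x ∈ segRL o) :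
    owner (vr := vr) x = Sum.inl (var vr o).castSucc := by
  simp only [segRL, List.mem_cons, List.not_mem_nil, or_false] at hx
  rcases hx with rfl | rfl | rfl | rfl | rfl | rfl <;> rfl

/-- Members of a variable piece are owned by the variable. [folklore] -/
theorem owner_of_mem_varPiece {v : Fin n} {x : Vtx n m} (hx : x ∈ varPiece vr v) :
    owner (vr := vr) x = Sum.inl v.castSucc := by
  rcases mem_varPiece_iff.1 hx with rfl | rfl | h | rfl | rfl | h | rfl <;> try rfl
  · obtain ⟨o, rfl, ho⟩ := mem_lrPart_iff.1 h; exact owner_of_mem_segLR ho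
  · obtain ⟨o, rfl, ho⟩ := mem_rlPart_iff.1 h; exact owner_of_mem_segRL ho

/-- Members of a block piece are owned by the constraint. [folklore] -/
theorem owner_of_mem_blockPiece {u : Fin m} {x : Vtx n m} (hx : x ∈ blockPiece (n := n) u) :
    owner (vr := vr) x = Sum.inr u.castSucc := by
  simp only [blockPiece, List.mem_cons, List.not_mem_nil, or_false] at hx
  rcases hx with rfl | rfl | rfl | rfl | rfl | rfl | rfl | rfl | rfl | rfl | rfl | rfl | rfl | rfl | rfl <;>
    simp [owner]

/-- A left-to-right segment has no duplicates. [folklore] -/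
theorem nodup_segLR (o : Occ m) : (segLR (n := n) o).Nodup := by
  simp [segLR]

/-- A right-to-left segment has no duplicates. [folklore] -/
theorem nodup_segRL (o : Occ m) : (segRL (n := n) o).Nodup := by
  simp [segRL]

/-- The slot of a vertex on a segment. [folklore] -/
def slotOf : Vtx n m → Option (Occ m)
  | nd _ o _ => some o
  | bm u i t _ => some (u, i, ⟨ZMod.val t, ZMod.val_lt t⟩)
  | _ => none

/-- Members of a left-to-right segment remember their slot. [folklore] -/
theorem slotOf_of_mem_segLR {o : Occ m} {x : Vtx n m} (hx : x ∈ segLR o) : slotOf x = some o := by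
  simp only [segLR, List.mem_cons, List.not_mem_nil, or_false] at hx
  rcases hx with rfl | rfl | rfl | rfl | rfl | rfl | rfl <;> try rfl
  rcases o with ⟨u, i, c⟩
  simp only [slotOf, Option.some.injEq, Prod.mk.injEq, true_and]
  apply Fin.ext
  simp only [toZ]
  fin_cases c <;> rfl

/-- Members of a right-to-left segment remember their slot. [folklore] -/
theorem slotOf_of_mem_segRL {o : Occ m} {x : Vtx n m} (hx : x ∈ segRL o) : slotOf x = some o := by
  simp only [segRL, List.mem_cons, List.not_mem_nil, or_false] at hx
  rcases hx with rfl | rfl | rfl | rfl | rfl | rfl <;> rfl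

/-- `K(v,0) →` has no duplicates. [folklore] -/
theorem nodup_lrPart (v : Fin n) : (lrPart vr v).Nodup := by
  rw [lrPart, List.nodup_flatMap]
  refine ⟨fun o _ => nodup_segLR o, (nodup_occs v).pairwise_of_forall_ne fun o _ o' _ hne => ?_⟩
  rw [Function.onFun, List.disjoint_left]
  intro x hx hx'
  exact hne (Option.some.inj ((slotOf_of_mem_segLR hx).symm.trans (slotOf_of_mem_segLR hx')))

/-- `K(v,1) ←` has no duplicates. [folklore] -/
theorem nodup_rlPart (v : Fin n) : (rlPart vr v).Nodup := by
  rw [rlPart, List.nodup_flatMap]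
  refine ⟨fun o _ => nodup_segRL o,
    (List.nodup_reverse.2 (nodup_occs v)).pairwise_of_forall_ne fun o _ o' _ hne => ?_⟩
  rw [Function.onFun, List.disjoint_left]
  intro x hx hx'
  exact hne (Option.some.inj ((slotOf_of_mem_segRL hx).symm.trans (slotOf_of_mem_segRL hx')))

/-- A coarse classification of vertices used to separate the parts of a variable piece. [folklore] -/
def vtag : Vtx n m → ℕ
  | cx _ => 0
  | hd _ a => if a = 0 then 1 else 2
  | tl _ a => if a = 0 then 3 else 4
  | nd a _ _ => if a = 0 then 5 else 6
  | bm _ _ _ _ => 5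
  | _ => 7

/-- Members of `K(v,0) →` have tag `5`. [folklore] -/
theorem vtag_of_mem_lrPart {v : Fin n} {x : Vtx n m} (hx : x ∈ lrPart vr v) : vtag x = 5 := by
  obtain ⟨o, -, ho⟩ := mem_lrPart_iff.1 hx
  simp only [segLR, List.mem_cons, List.not_mem_nil, or_false] at ho
  rcases ho with rfl | rfl | rfl | rfl | rfl | rfl | rfl <;> rfl

/-- Members of `K(v,1) ←` have tag `6`. [folklore] -/
theorem vtag_of_mem_rlPart {v : Fin n} {x : Vtx n m} (hx : x ∈ rlPart vr v) : vtag x = 6 := by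
  obtain ⟨o, -, ho⟩ := mem_rlPart_iff.1 hx
  simp only [segRL, List.mem_cons, List.not_mem_nil, or_false] at ho
  rcases ho with rfl | rfl | rfl | rfl | rfl | rfl <;> rfl

/-- **A variable piece has no duplicates.** [folklore] -/
theorem nodup_varPiece (v : Fin n) : (varPiece vr v).Nodup := by
  have t1 : ∀ x ∈ lrPart vr v, vtag x = 5 := fun x hx => vtag_of_mem_lrPart hx
  have t2 : ∀ x ∈ rlPart vr v, vtag x = 6 := fun x hx => vtag_of_mem_rlPart hx
  have key : ∀ x : Vtx n m, x ∈ lrPart vr v ++ tl v 0 :: tl v 1 :: (rlPart vr v ++ [hd v 1]) →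
      vtag x = 5 ∨ vtag x = 3 ∨ vtag x = 4 ∨ vtag x = 6 ∨ vtag x = 2 := by
    intro x hx
    simp only [List.mem_append, List.mem_cons, List.not_mem_nil, or_false] at hx
    rcases hx with h | rfl | rfl | h | rfl
    · exact Or.inl (t1 _ h)
    · exact Or.inr (Or.inl (by simp [vtag]))
    · exact Or.inr (Or.inr (Or.inl (by simp [vtag])))
    · exact Or.inr (Or.inr (Or.inr (Or.inl (t2 _ h))))
    · exact Or.inr (Or.inr (Or.inr (Or.inr (by simp [vtag]))))
  rw [varPiece, List.nodup_cons, List.mem_cons]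
  refine ⟨?_, ?_⟩
  · rintro (h | h)
    · exact absurd h (by simp)
    · have := key _ h; simp [vtag] at this
  rw [List.nodup_cons]
  refine ⟨fun h => by have := key _ h; simp [vtag] at this, ?_⟩
  rw [List.nodup_append]
  refine ⟨nodup_lrPart v, ?_, fun x hx y hy hxy => ?_⟩
  · rw [List.nodup_cons, List.mem_cons]
    refine ⟨?_, ?_⟩
    · rintro (h | h)
      · exact absurd h (by simp)
      · simp only [List.mem_append, List.mem_singleton] at h
        rcases h with h | h
        · have := t2 _ h; simp [vtag] at this
        · exact absurd h (by simp)
    rw [List.nodup_cons]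
    refine ⟨fun h => ?_, ?_⟩
    · simp only [List.mem_append, List.mem_singleton] at h
      rcases h with h | h
      · have := t2 _ h; simp [vtag] at this
      · exact absurd h (by simp)
    rw [List.nodup_append]
    refine ⟨nodup_rlPart v, List.nodup_singleton _, fun x hx y hy hxy => ?_⟩
    subst hxy; rw [List.mem_singleton] at hy; subst hy
    have := t2 _ hx; simp [vtag] at this
  · subst hxy
    have h5 := t1 _ hx
    simp only [List.mem_cons, List.mem_append, List.not_mem_nil, or_false] at hy
    rcases hy with rfl | rfl | h | rfl
    · simp [vtag] at h5
    · simp [vtag] at h5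
    · have := t2 _ h; omega
    · simp [vtag] at h5

/-- **A block piece has no duplicates.** [folklore] -/
theorem nodup_blockPiece (u : Fin m) : (blockPiece (n := n) u).Nodup := by
  simp [blockPiece]

/-- **The tour has no duplicates.** [folklore] -/
theorem nodup_tour : (tour vr).Nodup := by
  have hA : ∀ x ∈ (List.finRange n).flatMap (varPiece vr), ∃ v : Fin n, owner (vr := vr) x = Sum.inl v.castSucc := by
    intro x hx
    obtain ⟨v, -, hv⟩ := List.mem_flatMap.1 hx
    exact ⟨v, owner_of_mem_varPiece hv⟩
  have hB : ∀ x ∈ (List.finRange m).flatMap (blockPiece (n := n)),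
      ∃ u : Fin m, owner (vr := vr) x = Sum.inr u.castSucc := by
    intro x hx
    obtain ⟨u, -, hu⟩ := List.mem_flatMap.1 hx
    exact ⟨u, owner_of_mem_blockPiece hu⟩
  rw [tour, List.nodup_append]
  refine ⟨?_, ?_, fun x hx y hy hxy => ?_⟩
  · rw [List.nodup_flatMap]
    refine ⟨fun v _ => nodup_varPiece v, (List.nodup_finRange n).pairwise_of_forall_ne
      fun v _ v' _ hne => ?_⟩
    rw [Function.onFun, List.disjoint_left]
    intro x hx hx'
    have := (owner_of_mem_varPiece hx).symm.trans (owner_of_mem_varPiece hx')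
    exact hne (Fin.castSucc_injective _ (Sum.inl_injective this))
  · rw [List.nodup_cons]
    refine ⟨fun h => ?_, ?_⟩
    · rcases List.mem_append.1 h with h | h
      · obtain ⟨u, hu⟩ := hB _ h; simp [owner] at hu
      · simp at h
    rw [List.nodup_append]
    refine ⟨?_, List.nodup_singleton _, fun x hx y hy hxy => ?_⟩
    · rw [List.nodup_flatMap]
      refine ⟨fun u _ => nodup_blockPiece u, (List.nodup_finRange m).pairwise_of_forall_ne
        fun u _ u' _ hne => ?_⟩
      rw [Function.onFun, List.disjoint_left]
      intro x hx hx'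
      have := (owner_of_mem_blockPiece (vr := vr) hx).symm.trans (owner_of_mem_blockPiece hx')
      exact hne (Fin.castSucc_injective _ (Sum.inr_injective this))
    · subst hxy
      simp only [List.mem_singleton] at hy
      subst hy
      obtain ⟨u, hu⟩ := hB _ hx
      simp only [owner, Sum.inr.injEq] at hu
      exact absurd hu.symm (Fin.ne_of_lt (Fin.castSucc_lt_last u))
  · subst hxy
    obtain ⟨v, hv⟩ := hA _ hx
    simp only [List.mem_cons, List.mem_append, List.not_mem_nil, or_false] at hy
    rcases hy with rfl | h | rfl
    · simp only [owner, Sum.inl.injEq] at hv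
      exact absurd hv (Fin.ne_of_gt (Fin.castSucc_lt_last v))
    · obtain ⟨u, hu⟩ := hB _ h
      rw [hv] at hu; exact absurd hu (by simp)
    · simp [owner] at hv

/-- **The tour is a directed Hamiltonian cycle of the gadget of the zero system.** [folklore] -/
theorem isHamCycleListing_tour : IsHamCycleListing (Arc vr 0) (tour vr) := by
  rw [isHamCycleListing_iff_isChain]
  exact ⟨nodup_tour, mem_tour, isChain_tour_and_wrap.1, isChain_tour_and_wrap.2⟩

/-- The tour is nonempty. [folklore] -/
theorem tour_ne_nil : tour vr ≠ [] := by
  rw [tour]; simp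

/-- **Completeness for the zero system**: the split graph of `Arc vr 0` is Hamiltonian. [folklore] -/
theorem isHamiltonian_zero (vr : Fin m → Fin 3 → Fin n) : (splitGraph (Arc vr 0)).IsHamiltonian := by
  classical
  exact (isHamiltonian_splitGraph_iff (Arc vr 0)).2 ⟨tour vr, tour_ne_nil, isHamCycleListing_tour⟩

end TourProofs

end Tour

end XorHam

end Literature.Combinatorics.SimpleGraph
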